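import Summits.CriticalPhenomena.PercolationContinuityZ3.Theorems.Transplant.KNCellsBoxProdZ2R
import Summits.CriticalPhenomena.PercolationContinuityZ3.Theorems.Transplant.PlanarCellsPSep2
import Summits.CriticalPhenomena.PercolationContinuityZ3.Theorems.Transplant.KNCells2FacePrefix
import Summits.CriticalPhenomena.PercolationContinuityZ3.Theorems.Transplant.KNCells2Scheme
import Mathlib.Data.Pi.Interval
import Mathlib.Data.Int.Interval
import HarnessLib

/-!
# The `X □ ℤ²` cells with fibre radii, part 2: the LEVEL GEOMETRY (`LevelGeom`, hypothesis `hL` of `samePWitnessAt_of_kit₂'`), the envelope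
# bound `hB` (`#envRegion₂ ≤ B` uniformly over ALL anchor pairs) and the degree bound `hΔ` (BLUEPRINT-I-PHI §3 Φ13; KN p. 31 Step IV, p. 27)

builds on p205010 (kernel theorem, internal audit signed; external expert review pending) — nothing in this file uses p205010.
Lane `prim-bschramm`, seat `prim-bschramm-p3`; helper file (`--supports stmt-CriticalPhenomena-4575 --as helper`).  Continues `KNCellsBoxProdZ2R`.

* `levelDataR C : LevelData (W × Site 2) W` — `lev a' v δ y = σ (y.2_a - cen v_a)` (fibre-blind planar level), `L j = 5r + 10sj`, `ℓQ = 5r`;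
* `sep_prodR` — planar `KozmaNitzan.Sep` (d = 2) lifts to `KNCells.Sep (X □ ℤ²)` of product sets;
* **`levelGeomR`** — `LevelGeom (X □ zdGraph 2) (cellGeomR …) (faceDataR …) (levelDataR C)` (uses `M ≤ T` of `ϱ.Ordered`);
* `envRegion₂R_subset`, **`card_envRegion₂R_le`** — `#envRegion₂ h e a a' ≤ ((Δ+1)^Q + (Δ+1)^T) (30r+1)²` for every `a a'` (`T ≤ Q`);
* `degree_boxProdZ2_le` — `hΔ` with `Δ + 4` (re-export of `ProdKN.degree_prod_le`).

[cite: KozmaNitzan2024, §4 p. 27, p. 31 — the ℤ^d model]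
-/

noncomputable section

open scoped Classical

namespace Summit.CriticalPhenomena.PercolationContinuityZ3.Theorems

namespace Transplant

namespace BoxProdZ2

open Literature.Probability.Percolation Literature.Probability.LatticeModels SimpleGraph GadgetSystem ProbeHistory HSiteScheme Contour KNCells
open Literature.Probability.Percolation.KozmaNitzan.Cells (oth oth_ne sgOf sgOf_sign stepVec_apply_fst stepVec_apply_oth eq_oth_of_ne)
open Literature.Barriers.CriticalPhenomena (graphBall mem_graphBall_self)

variable {W : Type} (X : SimpleGraph W) [X.LocallyFinite]
variable (C : PCells) (a₀ : W) (anchor : W → Site 2 → Finset (Sym2 (W × Site 2)) → W)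

/-! ## The level geometry -/

/-- **The level data of the `X □ ℤ²` cells**: planar level along the macro-direction, `L j = 5r + 10sj`, `ℓQ = 5r`. [cite: KozmaNitzan2024, §4 p. 30] -/
def levelDataR : LevelData (W × Site 2) W where
  lev := fun _ v δ y => C.lev δ v y.2
  L := fun j => 5 * C.r + 10 * C.s * j
  ℓQ := 5 * C.r

omit [X.LocallyFinite] in
/-- **No-edge separation lifts from the plane to `X □ ℤ²`.** [folklore] -/
theorem sep_prodR {B B' : Finset W} {P P' : Finset (Site 2)} (h : KozmaNitzan.Sep (↑P : Set (Site 2)) ↑P') :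
    KNCells.Sep (X □ zdGraph 2) (B ×ˢ P) (B' ×ˢ P') := by
  intro y hy z hz
  have hy2 := (Finset.mem_product.1 hy).2
  have hz2 := (Finset.mem_product.1 hz).2
  refine ⟨fun heq => (h _ (Finset.mem_coe.2 hy2) _ (Finset.mem_coe.2 hz2)).1 (by rw [heq]), fun hadj => ?_⟩
  rcases (boxProd_adj).1 hadj with ⟨-, h2⟩ | ⟨h2, -⟩
  · exact (h _ (Finset.mem_coe.2 hy2) _ (Finset.mem_coe.2 hz2)).1 h2
  · exact (h _ (Finset.mem_coe.2 hy2) _ (Finset.mem_coe.2 hz2)).2 h2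

/-- A corridor point off the far region has level `≤ 5r`. [folklore] -/
theorem lev_le_of_mem_Hfull_not_Efar' {δ : MDir} {v t : Site 2} (ht : t ∈ C.Hfull v δ) (hn : t ∉ C.Efar v δ) :
    C.lev δ v t ≤ 5 * C.r := by
  by_contra hlt
  push Not at hlt
  apply hn
  rw [PCells.Hfull, PCells.mem_psBox_iff] at ht
  rw [PCells.Efar, PCells.mem_psBox_iff]
  unfold PCells.lev at hlt
  exact ⟨⟨by omega, by omega⟩, by omega, by omega⟩

/-- `F^{j+1}` lies in the far region, beyond level `5r + 10sj` (`j + 1 ≤ K`). [folklore] -/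
theorem Face_far' {δ : MDir} {v t : Site 2} {j : ℕ} (hjK : j + 1 ≤ C.K) (ht : t ∈ C.Face v δ (j + 1)) :
    t ∈ C.Efar v δ ∧ 5 * (C.r : ℤ) + 10 * C.s * j + 1 ≤ C.lev δ v t := by
  rw [PCells.Face, PCells.mem_psBox_iff] at ht
  have hs1 : (1 : ℤ) ≤ C.s := by exact_mod_cast C.hs
  have hrK : (C.r : ℤ) = C.K * C.s := by simp [PCells.r]
  have hjK' : (j : ℤ) + 1 ≤ C.K := by exact_mod_cast hjK
  have hb : 10 * (C.s : ℤ) * (j + 1) ≤ 10 * C.s * C.K := mul_le_mul_of_nonneg_left hjK' (by positivity)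
  push_cast at ht
  refine ⟨?_, by unfold PCells.lev; nlinarith [ht.1.1]⟩
  rw [PCells.Efar, PCells.mem_psBox_iff]
  exact ⟨⟨by nlinarith [ht.1.1], by nlinarith [ht.1.2]⟩, by omega, by omega⟩

/-- **`LevelGeom` for the `X □ ℤ²` cells with radii** (`M ≤ T` is used for `M_x ⊆ E^far`). [cite: KozmaNitzan2024, §4 p. 31 (Step IV)] -/
theorem levelGeomR {ϱ : FibRadii} (hϱ : ϱ.Ordered) (hanch : ∀ a v P, anchor a v P ∈ ballFin X a ϱ.anch) :
    LevelGeom (X □ zdGraph 2) (cellGeomR X C ϱ a₀ anchor hanch) (faceDataR X C ϱ) (levelDataR (W := W) C) where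
  adj_le a' v δ y z h := by
    change C.lev δ v z.2 ≤ C.lev δ v y.2 + 1
    rcases (boxProd_adj).1 h with ⟨-, h2⟩ | ⟨h2, -⟩
    · rw [h2]; omega
    · rcases C.lev_adj δ v h2 with h' | h' | h' <;> omega
  lev_Q a a' v δ _ y hy := C.lev_le_of_mem_Q (Finset.mem_product.1 hy).2
  lev_Hfull a' v δ y hy hn := by
    obtain ⟨h1, h2⟩ := Finset.mem_product.1 hy
    exact lev_le_of_mem_Hfull_not_Efar' C h2 fun h' => hn (Finset.mem_product.2 ⟨h1, h'⟩)
  ℓQ_lt j hj := by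
    change 5 * (C.r : ℤ) < 5 * C.r + 10 * C.s * j
    have hs1 : (1 : ℤ) ≤ C.s := by exact_mod_cast C.hs
    have : (1 : ℤ) ≤ j := by exact_mod_cast hj
    nlinarith
  mem_Stub a' v δ j _ _ y hy hl := by
    obtain ⟨h1, h2⟩ := Finset.mem_product.1 hy
    exact Finset.mem_product.2 ⟨h1, C.mem_Stub_of_mem_Hfull h2 hl⟩
  mem_Face a' v δ j _ _ y hy hl := by
    obtain ⟨h1, h2⟩ := Finset.mem_product.1 hy
    exact Finset.mem_product.2 ⟨h1, C.mem_Face_of_mem_Hfull h2 hl⟩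
  Face_far a' v δ j hjK t ht := by
    obtain ⟨h1, h2⟩ := Finset.mem_product.1 ht
    obtain ⟨hE, hl⟩ := Face_far' C (by change j + 1 ≤ C.K at hjK; exact hjK) h2
    exact ⟨Finset.mem_product.2 ⟨h1, hE⟩, hl⟩
  M_far a' v δ t ht := by
    obtain ⟨h1, h2⟩ := Finset.mem_product.1 ht
    have hl := C.lev_ge_of_mem_M_add (δ := δ) h2
    have hr : (1 : ℤ) ≤ C.r := by exact_mod_cast C.one_le_r
    have hrK : (C.r : ℤ) = C.K * C.s := by simp [PCells.r]
    refine ⟨Finset.mem_product.2 ⟨ballFin_mono X a' hϱ.M_le_T h1, C.M_add_stepVec_subset_Efar v δ h2⟩, ?_⟩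
    change 5 * (C.r : ℤ) + 10 * C.s * (C.K : ℕ) + 1 ≤ C.lev δ v t.2
    nlinarith
  Btw_sep_Efar a a' w δw du hdu := by
    change KNCells.Sep (X □ zdGraph 2) (ballFin X a ϱ.T ×ˢ C.Btw w δw) (ballFin X a' ϱ.T ×ˢ C.Efar (w + stepVec δw) du)
    rw [← C.Btw_rev' w δw]
    exact sep_prodR X (C.Btw_sep_Efar (w + stepVec δw) (Ne.symm hdu))
  Cell_sep_Efar b a' u v δ huv hux := sep_prodR X (C.Cell_sep_Efar huv hux)
  Zone_sep_Efar b a' u δ' v δ huv hux := sep_prodR X (C.Zone_sep_Efar huv hux δ')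

/-! ## The envelope bound and the degree bound -/

section Env

variable {X C a₀ anchor} {ϱ : FibRadii} {hanch : ∀ a v P, anchor a v P ∈ ballFin X a ϱ.anch}
variable {S : KSchA (W × Site 2) W} (hS : S.Γ = cellGeomR X C ϱ a₀ anchor hanch)
include hS

omit hS in
/-- A planar signed-box point with `|level| ≤ 15r` and transverse deviation `≤ 15r` lies in the square `cen v + [-15r, 15r]²`. [folklore] -/
theorem mem_cenSquare15 {δ : MDir} {v t : Site 2} (h1 : -(15 * (C.r : ℤ)) ≤ sgOf δ * (t δ.1 - C.cen v δ.1))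
    (h2 : sgOf δ * (t δ.1 - C.cen v δ.1) ≤ 15 * C.r) (h3 : C.cen v (oth δ.1) - 15 * C.r ≤ t (oth δ.1))
    (h4 : t (oth δ.1) ≤ C.cen v (oth δ.1) + 15 * C.r) :
    t ∈ Finset.Icc (C.cen v - ((15 * C.r : ℕ) : Site 2)) (C.cen v + ((15 * C.r : ℕ) : Site 2)) := by
  rw [C.mem_sq_iff]
  intro i
  rcases eq_or_ne i δ.1 with rfl | hi
  · rcases sgOf_sign δ with hs | hs <;> rw [hs] at h1 h2 <;> push_cast <;> constructor <;> omega
  · rw [eq_oth_of_ne hi]; push_cast; exact ⟨h3, h4⟩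

/-- **The envelope region lies in two fibre balls times the square `cen v + [-15r, 15r]²`** — for EVERY pair of anchors.
[cite: KozmaNitzan2024, §4 p. 27] -/
theorem envRegion₂R_subset [DecidableEq W] (hϱ : ϱ.Ordered) (h : ProbeHistory (W × Site 2)) (e : Site 2 × MDir) (a a' : W) :
    S.envRegion₂ (X □ zdGraph 2) h e a a' ⊆
      (ballFin X a ϱ.Q ∪ ballFin X a' ϱ.T) ×ˢ
        Finset.Icc (C.cen (tgt e) - ((15 * C.r : ℕ) : Site 2)) (C.cen (tgt e) + ((15 * C.r : ℕ) : Site 2)) := by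
  have hr : (1 : ℤ) ≤ C.r := by exact_mod_cast C.one_le_r
  have hs20 : 20 * (C.s : ℤ) ≤ C.r := by exact_mod_cast C.twenty_mul_s_le_r
  have hTQ : ϱ.T ≤ ϱ.Q := by have := hϱ.anch_T; omega
  intro y hy
  rw [KSchA.envRegion₂, Finset.mem_union] at hy
  rcases hy with hy | hy
  · have hy' : y ∈ ballFin X a ϱ.T ×ˢ C.Btw e.1 e.2 ∪ ballFin X a ϱ.Q ×ˢ C.Q (tgt e) := by rw [hS] at hy; exact hy
    rcases Finset.mem_union.1 hy' with hy'' | hy''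
    · obtain ⟨h1, h2⟩ := Finset.mem_product.1 hy''
      rw [show C.Btw e.1 e.2 = C.Btw (tgt e) (rev e.2) from (C.Btw_rev' e.1 e.2).symm, PCells.Btw, PCells.mem_psBox_iff] at h2
      refine Finset.mem_product.2 ⟨Finset.mem_union_left _ (ballFin_mono X a hTQ h1), ?_⟩
      exact mem_cenSquare15 (C := C) (δ := rev e.2) (by linarith [h2.1.1]) (by linarith [h2.1.2]) (by linarith [h2.2.1]) (by linarith [h2.2.2])
    · obtain ⟨h1, h2⟩ := Finset.mem_product.1 hy''
      refine Finset.mem_product.2 ⟨Finset.mem_union_left _ h1, ?_⟩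
      rw [PCells.Q, C.mem_sq_iff] at h2
      rw [C.mem_sq_iff]
      intro i; have := h2 i; push_cast at this ⊢; constructor <;> omega
  · rw [Finset.mem_biUnion] at hy
    obtain ⟨du, -, hy⟩ := hy
    have hy' : y ∈ ballFin X a' ϱ.T ×ˢ C.Stub (tgt e) du (S.Γ.K - 1) := by
      have : S.Γ.Stub a' (tgt e) du (S.Γ.K - 1) = ballFin X a' ϱ.T ×ˢ C.Stub (tgt e) du (S.Γ.K - 1) := by rw [hS]; rfl
      rw [this] at hy; exact hy
    obtain ⟨h1, h2⟩ := Finset.mem_product.1 hy'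
    have hK : S.Γ.K = C.K := by rw [hS]; rfl
    rw [hK, PCells.Stub, PCells.mem_psBox_iff] at h2
    have hsK : 10 * (C.s : ℤ) * ((C.K - 1 : ℕ) : ℤ) ≤ 10 * C.r - 10 * C.s := by
      have hK1 : 1 ≤ C.K := by have := C.hK; omega
      have hrK : (C.r : ℤ) = C.K * C.s := by simp [PCells.r]
      push_cast [hK1]; nlinarith
    refine Finset.mem_product.2 ⟨Finset.mem_union_right _ h1, ?_⟩
    exact mem_cenSquare15 (C := C) (δ := du) (by linarith [h2.1.1]) (by linarith [h2.1.2]) (by linarith [h2.2.1]) (by linarith [h2.2.2])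

omit hS in
/-- The square `cen v + [-n, n]²` has `(2n+1)²` points. [folklore] -/
theorem card_cenSquare (v : Site 2) (n : ℕ) :
    (Finset.Icc (C.cen v - ((n : ℕ) : Site 2)) (C.cen v + ((n : ℕ) : Site 2))).card = (2 * n + 1) ^ 2 := by
  rw [Pi.card_Icc]
  simp only [Pi.sub_apply, Pi.add_apply, Pi.natCast_apply, Int.card_Icc]
  have h : ∀ i, (C.cen v i + (n : ℤ) + 1 - (C.cen v i - (n : ℤ))).toNat = 2 * n + 1 := fun i => by omega
  simp only [h, Finset.prod_const, Finset.card_univ, Fintype.card_fin]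

/-- **The envelope bound `hB`**: `#envRegion₂ h e a a' ≤ ((Δ+1)^Q + (Δ+1)^T) (30r+1)²` for all anchor pairs, `X` of degree `≤ Δ`.
[cite: KozmaNitzan2024, §4 p. 27] -/
theorem card_envRegion₂R_le [DecidableEq W] (hϱ : ϱ.Ordered) {Δ : ℕ} (hΔ : ∀ w, X.degree w ≤ Δ) (h : ProbeHistory (W × Site 2))
    (e : Site 2 × MDir) (a a' : W) :
    (S.envRegion₂ (X □ zdGraph 2) h e a a').card ≤ ((Δ + 1) ^ ϱ.Q + (Δ + 1) ^ ϱ.T) * (30 * C.r + 1) ^ 2 := by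
  refine (Finset.card_le_card (envRegion₂R_subset hS hϱ h e a a')).trans ?_
  rw [Finset.card_product, card_cenSquare]
  have h2 : (2 * (15 * C.r) + 1) ^ 2 = (30 * C.r + 1) ^ 2 := by ring
  rw [h2]
  refine Nat.mul_le_mul_right _ ((Finset.card_union_le _ _).trans ?_)
  exact Nat.add_le_add (card_ballFin_le X hΔ a ϱ.Q) (card_ballFin_le X hΔ a' ϱ.T)

end Env

omit [X.LocallyFinite] in
/-- **The degree bound `hΔ` of `X □ ℤ²`**: `Δ_X + 4`. [folklore] -/
theorem degree_boxProdZ2_le [X.LocallyFinite] {Δ : ℕ} (hΔ : ∀ w, X.degree w ≤ Δ) (x : W × Site 2) : (X □ zdGraph 2).degree x ≤ Δ + 4 :=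
  ProdKN.degree_prod_le X hΔ x

end BoxProdZ2

end Transplant

end Summit.CriticalPhenomena.PercolationContinuityZ3.Theorems

end
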